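import Summits.Ventures.YMGap.RobustBall.StarDoorZdWMassive
import Summits.Ventures.YMGap.RobustBall.RobustStarDoorZdW
import Summits.Ventures.YMGap.RobustBall.MassGapOnBallZdSMassive
import HarnessLib

/-!
# Venture YMGap, track ROBUST-BALL (Y2) — crux Y2-X2-WZd-M, step 2: «EVERY MEMBER OF THE TIER-2 (DIAMETER-WEIGHTED,
# INFINITE-RANGE) `ℤ^d` BALL HAS A MASSIVE DLR STATE THROUGH THE ROBUST VERTEX-STAR DOOR»

HONEST FRAMING. WHAT THIS IS: a venture file (cell `pub-ymgap`, track Y2 ROBUST-BALL, seat ds-2), strong-coupling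
LATTICE statements for `SU(N)` lattice Yang–Mills on `ℤ^d` with a PERTURBED action `N β S_W + W`, `W` in the
gauge-invariant diameter-weighted tier-2 ball `MemBallZdW κ ε₀ ε₁` (`MassGapOnBallZdW.lean`: summable link
potentials of ARBITRARY range, `Σ_{X ∋ e} e^{κ·diam X} osc_e W_X ≤ ε₀` per link, `Σ_{X at v} e^{κ·diam X} Σ_y Lip_y W_X ≤ ε₁`
per site).
* `MemBallZdW.exists_lipRows` — the ball's site-incidence weighted Lipschitz load dominates rb-p1's
  diagonal-free WEIGHTED ROWS at every weight `0 ≤ t ≤ κ`: `Σ'_y 𝟙[y ≠ e] ℓ(e, y) e^{t‖e − y‖} ≤ ε₁` with the cross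
  coefficient `ℓ(e, y) = Σ'_{X ∋ e, y} Lip_y W_X` (a double series exchanged by `tsum_comm`; `‖e − y‖_∞ ≤ diam X`).
* `massiveClause_of_starWindowBoundZdW` — DOOR LEVEL: for a member `W ∈ MemBallZdW κ ε₀ ε₁` whose tier-2
  specification `perturbedYMS (fundamentalRep (Fin N)) β W` carries the weighted star window bound at a rate
  `0 < t ≤ κ` (`StarWindowBoundZdW … t ρ reach`, `ρ < 1`), EVERY DLR state has the Osterwalder–Seiler clause:
  `cov_μ(F₁, F₂ ∘ θ_x)` decays at rate `t` for ALL bounded measurable local `F₁, F₂` (every `d ≥ 1`; the massive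
  bridge `perturbedS_covariance_decay_of_starWindowBoundZdW` of `StarDoorZdWMassive.lean` fed with `exists_lipRows`).
* `massive_of_starWindowBoundZdW` — `d = 4`: DLR states exist and EVERY DLR state is MASSIVE
  (`Literature.Barriers.QuantumFields.IsMassiveState`) with exponentially decaying plaquette–plaquette correlation
  function (tree criterion `not_exists_clusteringRate_of_not_hasExponentialDecay_plaquetteCorrFn`).
* `starWindowBoundZdW_of_robustStar` — the ROBUST VERTEX-STAR DOOR of `RobustStarDoorZdW.lean` with its
  conclusion one step earlier: under the hypotheses of `massGapOnBallZdW_of_robustStar` VERBATIM, every member of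
  `MemBallZdW κ ε₀ ε₁` carries `StarWindowBoundZdW (perturbedYMS … (N β') W) t ρ' (fun s y => ‖y.1 − s‖ + 1)` — so
  every (β⋆, ε) cell of the tier-2 `ℤ^d` mass-gap table (`StarWindowZdWRowsSU2.lean`, `MassGapOnBallZdWRows*.lean`) is ALSO a
  massive-state cell (`TierTwoMassiveSU2.lean`): `SU(2)`, `d = 4`, up to `β_W = 1/3` — today's tier-2 massive rows
  (`MassGapOnBallZdSMassive.lean`, single-link pair) stop at `β_W ≤ 1/6`.
WHAT THIS IS NOT: the rate is the door rate `t` (a door artefact); nothing about the continuum, confinement, a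
transfer-matrix gap or the Clay problem.
References: K. Osterwalder, E. Seiler, Ann. Phys. 110 (1978) §4; H. Föllmer, LNM 1362 (1988) Ch. I; H.-O. Georgii
(2011) Remark 8.26; I. Montvay, G. Münster (1994) §3.4.5.
-/

noncomputable section

open MeasureTheory ProbabilityTheory Function Finset Filter Topology
open scoped NNReal
open Literature.Probability.LatticeModels
open Literature.Probability.LatticeModels.DobrushinMetric
open Literature.MathematicalPhysics.QuantumLattice hiding torusNorm
open Literature.MathematicalPhysics.QuantumFieldTheory hiding ZdEdge
open Literature.MathematicalPhysics.QuantumFieldTheory.Balaban1983to89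
open Literature.MathematicalPhysics.QuantumFieldTheory.Balaban1983to89.StrongCouplingDobrushinWindow
  (OneLinkKRModulus)
open Literature.Barriers.QuantumFields (IsMassiveState)
open Summit.QuantumFields.BalabanUV.InfraRed.StrongCouplingPoincareDoorSUN (OneLinkPoincareSUN)
open Summit.QuantumFields.BalabanUV.InfraRed.StrongCouplingVarianceDoorSUN (OneLinkVarianceBound)
open Summit.Ventures.YMGap.DSWindowZd
open Summit.Ventures.YMGap.StarResolventDim (gaugeR doorPoly)

namespace Summit.Ventures.YMGap.RobustBall

variable {d N : ℕ}

/-! ### The weighted rows of a member of the diameter-weighted ball -/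

/-- **The site-incidence weighted load of `MemBallZdW κ ε₀ ε₁` dominates the diagonal-free weighted rows at every
weight `0 ≤ t ≤ κ`.** For a member `W` there are Lipschitz witnesses `lip` and the cross coefficient
`ℓ(e, y) = Σ'_{X ∋ e, y} lip_X(y)` with summable cross moduli and `Σ'_y 𝟙[y ≠ e] ℓ(e, y) e^{t‖e − y‖_∞} ≤ ε₁` for every
link `e` — exactly the row data of ds-3's `exists_globalLip_specAvg_perturbedYMS` / the massive bridge
(`‖e − y‖_∞ ≤ diam X` for `e, y ∈ X`, `t ≤ κ`, and `X ∋ e` is based at `e.1`). [folklore] -/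
theorem MemBallZdW.exists_lipRows {κ ε₀ ε₁ t : ℝ} {W : Potential (ZdEdge d) (SUN N)} (hW : MemBallZdW κ ε₀ ε₁ W)
    (ht : 0 ≤ t) (htκ : t ≤ κ) :
    ∃ (lip : Finset (ZdEdge d) → ZdEdge d → ℝ) (ℓ : ZdEdge d → ZdEdge d → ℝ),
      (∀ X, IsLipBound suFrobDist (W X) (lip X)) ∧
      (∀ e y, Summable fun X : Finset (ZdEdge d) => (if e ∈ X ∧ y ∈ X then lip X y else 0)) ∧
      (∀ e y, y ≠ e → ∑' X : Finset (ZdEdge d), (if e ∈ X ∧ y ∈ X then lip X y else 0) ≤ ℓ e y) ∧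
      (∀ e, Summable fun y => (if y = e then 0 else ℓ e y) * Real.exp (t * ‖e.1 - y.1‖)) ∧
      (∀ e, ∑' y, (if y = e then 0 else ℓ e y) * Real.exp (t * ‖e.1 - y.1‖) ≤ ε₁) := by
  classical
  obtain ⟨osc, lip, -, hlip, -, -, hlips, hlipa⟩ := hW.loads
  have hκ : 0 ≤ κ := ht.trans htκ
  have hlip0 : ∀ X y, 0 ≤ lip X y := fun X y => (hlip X).nonneg y
  -- the site load majorant through the link `e`
  set F : ZdEdge d → Finset (ZdEdge d) → ℝ := fun e X =>
    if (∃ μ : Fin d, ((e.1, μ) : ZdEdge d) ∈ X) then Real.exp (κ * linkDiamZd X) * ∑ y ∈ X, lip X y else 0 with hF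
  have hFs : ∀ e, Summable (F e) := fun e => hlips e.1
  have hFle : ∀ e, ∑' X, F e X ≤ ε₁ := fun e => hlipa e.1
  have hsum0 : ∀ X, 0 ≤ ∑ y ∈ X, lip X y := fun X => Finset.sum_nonneg fun y _ => hlip0 X y
  have hF0 : ∀ e X, 0 ≤ F e X := fun e X => by
    simp only [hF]; split_ifs; exacts [mul_nonneg (Real.exp_nonneg _) (hsum0 X), le_rfl]
  have hbase : ∀ {e : ZdEdge d} {X : Finset (ZdEdge d)}, e ∈ X → ∃ μ : Fin d, ((e.1, μ) : ZdEdge d) ∈ X :=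
    fun {e X} he => ⟨e.2, by simpa using he⟩
  have hone : ∀ X, ∑ y ∈ X, lip X y ≤ Real.exp (κ * linkDiamZd X) * ∑ y ∈ X, lip X y := fun X =>
    le_mul_of_one_le_left (hsum0 X) (Real.one_le_exp (by positivity))
  -- the pointwise cross modulus is dominated by the site load
  have hterm : ∀ e y X, (if e ∈ X ∧ y ∈ X then lip X y else 0) ≤ F e X := by
    intro e y X
    split_ifs with h
    · simp only [hF, if_pos (hbase h.1)]
      exact ((Finset.single_le_sum (fun y' _ => hlip0 X y') h.2).trans (hone X))
    · exact hF0 e X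
  have hlips' : ∀ e y, Summable fun X : Finset (ZdEdge d) => (if e ∈ X ∧ y ∈ X then lip X y else 0) :=
    fun e y => Summable.of_nonneg_of_le (fun X => by split_ifs; exacts [hlip0 X y, le_rfl]) (hterm e y) (hFs e)
  refine ⟨lip, fun e y => ∑' X : Finset (ZdEdge d), (if e ∈ X ∧ y ∈ X then lip X y else 0), hlip, hlips',
    fun e y _ => le_rfl, ?_⟩
  -- the weighted rows: exchange the two series
  have hrow : ∀ e : ZdEdge d,
      Summable (fun y => (if y = e then 0 else ∑' X : Finset (ZdEdge d), (if e ∈ X ∧ y ∈ X then lip X y else 0)) *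
        Real.exp (t * ‖e.1 - y.1‖)) ∧
      ∑' y, (if y = e then 0 else ∑' X : Finset (ZdEdge d), (if e ∈ X ∧ y ∈ X then lip X y else 0)) *
        Real.exp (t * ‖e.1 - y.1‖) ≤ ε₁ := by
    intro e
    set G : Finset (ZdEdge d) → ZdEdge d → ℝ := fun X y =>
      if e ∈ X ∧ y ∈ X ∧ y ≠ e then lip X y * Real.exp (t * ‖e.1 - y.1‖) else 0 with hG
    have hG0 : ∀ X y, 0 ≤ G X y := fun X y => by
      simp only [hG]; split_ifs; exacts [mul_nonneg (hlip0 X y) (Real.exp_nonneg _), le_rfl]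
    -- the row term is the `X`-series of `G`
    have hident : ∀ y, (if y = e then 0 else ∑' X : Finset (ZdEdge d), (if e ∈ X ∧ y ∈ X then lip X y else 0)) *
        Real.exp (t * ‖e.1 - y.1‖) = ∑' X, G X y := by
      intro y
      by_cases hye : y = e
      · rw [if_pos hye, zero_mul]
        have h0 : (fun X => G X y) = fun _ => 0 := funext fun X => by
          simp only [hG]; rw [if_neg (fun h => h.2.2 hye)]
        rw [h0, tsum_zero]
      · rw [if_neg hye, ← tsum_mul_right]
        refine tsum_congr fun X => ?_
        simp only [hG]
        by_cases h : e ∈ X ∧ y ∈ X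
        · rw [if_pos h, if_pos ⟨h.1, h.2, hye⟩]
        · rw [if_neg h, if_neg (fun h' => h ⟨h'.1, h'.2.1⟩), zero_mul]
    -- per-`X` finite sums: `Σ_{y ∈ X} G X y ≤ F e X`
    have hfin : ∀ X, ∑' y, G X y = ∑ y ∈ X, G X y := fun X =>
      tsum_eq_sum fun y hy => by simp only [hG]; rw [if_neg (fun h => hy h.2.1)]
    have hXle : ∀ X, ∑ y ∈ X, G X y ≤ F e X := by
      intro X
      by_cases he : e ∈ X
      · have h1 : ∑ y ∈ X, G X y ≤ ∑ y ∈ X, lip X y * Real.exp (κ * linkDiamZd X) := by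
          refine Finset.sum_le_sum fun y hy => ?_
          simp only [hG]
          split_ifs with h
          · refine mul_le_mul_of_nonneg_left (Real.exp_le_exp.2 ?_) (hlip0 X y)
            have hdiam : ‖e.1 - y.1‖ ≤ (linkDiamZd X : ℝ) := norm_sub_le_linkDiamZd he hy
            have hD0 : (0 : ℝ) ≤ linkDiamZd X := Nat.cast_nonneg _
            nlinarith
          · exact mul_nonneg (hlip0 X y) (Real.exp_nonneg _)
        refine h1.trans ?_
        rw [← Finset.sum_mul, mul_comm]
        simp only [hF, if_pos (hbase he)]
        exact le_rfl
      · have h0 : ∑ y ∈ X, G X y = 0 := Finset.sum_eq_zero fun y _ => by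
          simp only [hG]; rw [if_neg (fun h => he h.1)]
        rw [h0]; exact hF0 e X
    have hsumX : Summable fun X => ∑' y, G X y := by
      simp_rw [hfin]
      exact Summable.of_nonneg_of_le (fun X => Finset.sum_nonneg fun y _ => hG0 X y) hXle (hFs e)
    have hunc : Summable (Function.uncurry G) :=
      (summable_prod_of_nonneg fun p => hG0 p.1 p.2).2
        ⟨fun X => summable_of_ne_finset_zero (s := X) fun y hy => by
          show G X y = 0; simp only [hG]; rw [if_neg (fun h => hy h.2.1)], hsumX⟩
    have hswap : Summable fun p : ZdEdge d × Finset (ZdEdge d) => G p.2 p.1 := hunc.prod_symm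
    have hy : Summable fun y : ZdEdge d => ∑' X, G X y :=
      ((summable_prod_of_nonneg fun p => hG0 p.2 p.1).1 hswap).2
    simp_rw [hident]
    refine ⟨hy, ?_⟩
    rw [hunc.tsum_comm]
    calc ∑' X, ∑' y, G X y ≤ ∑' X, F e X := hsumX.tsum_le_tsum (fun X => by rw [hfin]; exact hXle X) (hFs e)
      _ ≤ ε₁ := hFle e
  exact ⟨fun e => (hrow e).1, fun e => (hrow e).2⟩

/-! ### Door level: the weighted star window bound ⇒ every DLR state is massive -/

/-- **EVERY `d ≥ 1`: THE OSTERWALDER–SEILER CLAUSE FOR EVERY DLR STATE OF A MEMBER OF THE TIER-2 BALL THROUGH THE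
STAR DOOR** (`SU(N)`, `N ≥ 1`, tree coupling `β`): if `W ∈ MemBallZdW κ ε₀ ε₁` and the tier-2 specification
`perturbedYMS (fundamentalRep (Fin N)) β W` carries the weighted star window bound `StarWindowBoundZdW … t ρ reach`
at a rate `0 < t ≤ κ` with `0 ≤ ρ < 1` and a reach dominating the sup-distance from the star, then for every DLR
state `μ` there is a rate (`m = t`) at which `cov_μ(F₁, F₂ ∘ θ_x)` decays exponentially for ALL bounded measurable
local observables `F₁, F₂`. [folklore] -/
theorem massiveClause_of_starWindowBoundZdW (hd : 1 ≤ d) (hN : 1 ≤ N) {β κ ε₀ ε₁ t ρ : ℝ}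
    {W : Potential (ZdEdge d) (SUN N)} (hW : MemBallZdW κ ε₀ ε₁ W) (ht : 0 < t) (htκ : t ≤ κ)
    (hρ0 : 0 ≤ ρ) (hρ1 : ρ < 1) {reach : Site d → ZdEdge d → ℝ} (hreach0 : ∀ s y, 0 ≤ reach s y)
    (hreach : ∀ (s : Site d), ∀ x ∈ vertexStarZd s, ∀ y : ZdEdge d, ‖x.1 - y.1‖ ≤ reach s y)
    (hdoor : StarWindowBoundZdW d N (perturbedYMS (d := d) (fundamentalRep (Fin N)) β W) t ρ reach suFrobDist) :
    ∀ μ ∈ perturbedGibbsMeasuresS (d := d) (fundamentalRep (Fin N)) β W,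
      ∃ m : ℝ, ∀ F₁ F₂ : LGConfig d (SUN N) → ℝ,
        Literature.MathematicalPhysics.QuantumLattice.IsLocalObservable F₁ →
        Literature.MathematicalPhysics.QuantumLattice.IsLocalObservable F₂ →
        Measurable F₁ → Measurable F₂ → (∃ C, ∀ U, |F₁ U| ≤ C) → (∃ C, ∀ U, |F₂ U| ≤ C) →
          HasExponentialDecayRate
            (fun x : Site d => cov[F₁, fun U => F₂ (Literature.MathematicalPhysics.QuantumLattice.configShift x U); μ]) m := by
  intro μ hμ
  obtain ⟨B, hB⟩ := hW.summable
  obtain ⟨lip, ℓ, hlip, hlips, hℓ, hℓs, hℓt⟩ := hW.exists_lipRows ht.le htκ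
  refine ⟨t, fun F₁ F₂ h₁ h₂ h₁m h₂m hb₁ hb₂ => ⟨ht, ?_⟩⟩
  exact perturbedS_covariance_decay_of_starWindowBoundZdW hd hN β hB hW.continuous hW.dependsOn hlip hlips hℓ ht hℓs
    hℓt hρ0 hρ1 hreach0 hreach hdoor hμ F₁ F₂ h₁ h₂ h₁m h₂m hb₁ hb₂

/-- ★ **`d = 4`: DLR STATES EXIST AND EVERY DLR STATE OF THE MEMBER IS MASSIVE, THROUGH THE STAR DOOR** (`SU(N)`,
`N ≥ 1`): under the hypotheses of `massiveClause_of_starWindowBoundZdW` at `d = 4`, the member has DLR states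
(`perturbedGibbsMeasuresS_nonempty`) and EVERY DLR state is an Osterwalder–Seiler MASSIVE STATE (`IsMassiveState`,
rate `t`; the gauge-invariance binders of that predicate are not needed) with exponentially decaying
plaquette–plaquette correlation function. (The door also gives exactly one DLR state:
`perturbedMassGapAtS_of_starWindowBoundZdW`.) [folklore] -/
theorem massive_of_starWindowBoundZdW (hN : 1 ≤ N) {β κ ε₀ ε₁ t ρ : ℝ}
    {W : Potential (ZdEdge 4) (SUN N)} (hW : MemBallZdW κ ε₀ ε₁ W) (ht : 0 < t) (htκ : t ≤ κ)
    (hρ0 : 0 ≤ ρ) (hρ1 : ρ < 1) {reach : Site 4 → ZdEdge 4 → ℝ} (hreach0 : ∀ s y, 0 ≤ reach s y)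
    (hreach : ∀ (s : Site 4), ∀ x ∈ vertexStarZd s, ∀ y : ZdEdge 4, ‖x.1 - y.1‖ ≤ reach s y)
    (hdoor : StarWindowBoundZdW 4 N (perturbedYMS (d := 4) (fundamentalRep (Fin N)) β W) t ρ reach suFrobDist) :
    (perturbedGibbsMeasuresS (d := 4) (fundamentalRep (Fin N)) β W).Nonempty ∧
      ∀ μ ∈ perturbedGibbsMeasuresS (d := 4) (fundamentalRep (Fin N)) β W,
        IsMassiveState μ ∧ HasExponentialDecay (plaquetteCorrFn (fundamentalRep (Fin N)) μ) := by
  haveI : SecondCountableTopology (Matrix (Fin N) (Fin N) ℂ) :=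
    inferInstanceAs (SecondCountableTopology (Fin N → Fin N → ℂ))
  haveI : SecondCountableTopology (SUN N) := Topology.IsEmbedding.subtypeVal.secondCountableTopology
  obtain ⟨B, hB⟩ := hW.summable
  refine ⟨perturbedGibbsMeasuresS_nonempty _ (continuous_fundamentalRep (Fin N)) _ hB hW.continuous hW.dependsOn,
    fun μ hμ => ?_⟩
  have hGibbs : IsGibbsMeasure (perturbedYMS (d := 4) (fundamentalRep (Fin N)) β W) μ := hμ
  haveI : IsProbabilityMeasure μ := hGibbs.isProbabilityMeasure
  obtain ⟨m, hm⟩ := massiveClause_of_starWindowBoundZdW (d := 4) (by norm_num) hN hW ht htκ hρ0 hρ1 hreach0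
    hreach hdoor μ hμ
  refine ⟨⟨m, fun F₁ F₂ h₁ h₂ h₁m h₂m hb₁ hb₂ _ _ => hm F₁ F₂ h₁ h₂ h₁m h₂m hb₁ hb₂⟩, ?_⟩
  by_contra hneg
  exact Literature.Barriers.QuantumFields.not_exists_clusteringRate_of_not_hasExponentialDecay_plaquetteCorrFn
    (fundamentalRep (Fin N)) (continuous_fundamentalRep (Fin N))
    (fun U => fundamentalRep_mem_unitaryGroup U) hneg
    ⟨m, fun F₁ F₂ h₁ h₂ h₁m h₂m hb₁ hb₂ _ _ => hm F₁ F₂ h₁ h₂ h₁m h₂m hb₁ hb₂⟩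

/-! ### The robust vertex-star door, stopped at the window bound -/

/-- **THE ROBUST VERTEX-STAR DOOR ON THE TIER-2 `ℤ^d` BALL GIVES THE WEIGHTED STAR WINDOW BOUND** — the hypotheses
of `massGapOnBallZdW_of_robustStar` VERBATIM (near data: one-link modulus `K` at radius `Rm ≥ 2(d−1)|β'|`,
per-incidence coefficient `c`, cross row `lam`, in-star row `θ < 1`, `doorPoly d c < 1`, near received sum `ρn`;
far data: weight `κ > 0`, rate `0 < t ≤ κ`, box radius `D ≥ 1`, far tilt bound `τb`, closing inequality `hclose`
with `ρ' < 1`), conclusion: every member `W ∈ MemBallZdW κ ε₀ ε₁` carries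
`StarWindowBoundZdW (perturbedYMS (fundamentalRep (Fin N)) (N β') W) t ρ' (fun s y => ‖y.1 − s‖ + 1)` — the first two
steps of that door's proof, named, so that every cell of the tier-2 mass-gap table is also a massive-state cell
(`massive_of_starWindowBoundZdW`). [folklore] -/
theorem starWindowBoundZdW_of_robustStar (hd : 2 ≤ d) (hN : 1 ≤ N)
    {β' κ ε₀ ε₁ Rm K c lam θ ρn t τb ρ' : ℝ} {D Kn : ℕ} (hD : 1 ≤ D)
    (hK : 0 ≤ K) (hRm : |(N : ℝ) * β'| / N * (2 * ((d : ℝ) - 1)) ≤ Rm) (hmod : OneLinkKRModulus N Rm K)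
    (hε₁ : 0 ≤ ε₁)
    (hc : K * Real.exp ε₀ * (1 + 2 * Real.sqrt N * ε₁) * (|(N : ℝ) * β'| / N) ≤ c) (hlam : Real.sqrt N * ε₁ ≤ lam)
    (hθ : θ = (2 * (d : ℝ) - 2) * c + lam) (hθ1 : θ < 1) (hcd : doorPoly d c < 1)
    (hρn : ρn = gaugeR d c + (lam + θ ^ Kn * (4 * d * lam)) / (1 - θ))
    (hκ : 0 < κ) (ht : 0 < t) (htκ : t ≤ κ)
    (hτb : (2 * Real.sqrt N) * (((d : ℝ) + 1) * Real.exp (-(κ * D)) * ε₁) ≤ τb)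
    (hclose : Real.exp τb ^ 2 * Real.exp (t * ((max (2 * D) 1 + 2 : ℕ) + 1)) * ρn +
        (2 * Real.sqrt N) * (Real.exp τb ^ 2 + Real.exp τb ^ 4) * (((d : ℝ) + 1) * Real.exp (-(κ * D)) * ε₁) *
          (Real.exp (t * ((max (2 * D) 1 + 2 : ℕ) + 1)) * ρn) +
        2 * (2 * Real.sqrt N) * (Real.exp τb ^ 2 + Real.exp τb ^ 4) *
          (((d : ℝ) + 1) * Real.exp (2 * t) * Real.exp (-((κ - t) * D)) * ε₁) ≤ ρ')
    {W : Potential (ZdEdge d) (SUN N)} (hW : MemBallZdW κ ε₀ ε₁ W) :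
    StarWindowBoundZdW d N (perturbedYMS (d := d) (fundamentalRep (Fin N)) ((N : ℝ) * β') W) t ρ'
      (fun s y => ‖y.1 - s‖ + 1) suFrobDist := by
  -- the first two steps of `massGapOnBallZdW_of_robustStar` (this seat, g10/g11)
  have hD'eq : 2 * D + 2 ≤ max (2 * D) 1 + 2 := by omega
  have hnear : ∀ s : Site d, StarWindowBoundZdR d N
      (perturbedYM (d := d) (fundamentalRep (Fin N)) ((N : ℝ) * β') (truncZd D s W) (truncSuppZd D s))
      (max (2 * D) 1 + 2) ρn suFrobDist := fun s =>
    starWindowBoundZdR_of_memBallZdG hd hN hK hRm hmod hε₁ hc hlam hθ hθ1 hcd hρn (hW.truncZd_mem hκ.le D s)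
  exact starWindowBoundZdW_of_near (N := N) hD'eq hκ ht.le htκ hτb (by exact_mod_cast hclose) hW hnear

/-- The star reach `‖y.1 − s‖ + 1` dominates the sup-distance from every link of the star of `s` (packaged, link first, for the
door's `hreach` slot; the cell files use `norm_sub_le_starReach` of `StarWindowZdWRowsSU2.lean`). [folklore] -/
private theorem starReach_dom (y : ZdEdge d) (s : Site d) {x : ZdEdge d} (hx : x ∈ vertexStarZd s) :
    ‖x.1 - y.1‖ ≤ ‖y.1 - s‖ + 1 := by
  calc ‖x.1 - y.1‖ = ‖(x.1 - s) - (y.1 - s)‖ := by congr 1; abel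
    _ ≤ ‖x.1 - s‖ + ‖y.1 - s‖ := norm_sub_le _ _
    _ ≤ 1 + ‖y.1 - s‖ := by linarith [norm_sub_le_one_of_mem_vertexStarZd hx]
    _ = ‖y.1 - s‖ + 1 := by ring

/-- ★★ **EVERY MEMBER OF THE TIER-2 WEIGHTED `ℤ⁴` BALL HAS A MASSIVE DLR STATE, THROUGH THE ROBUST VERTEX-STAR DOOR**
(`d = 4`, `SU(N)`, `N ≥ 1`): under the hypotheses of `massGapOnBallZdW_of_robustStar` at `d = 4`, for EVERY member
`W ∈ MemBallZdW κ ε₀ ε₁` DLR states of `perturbedYMS (fundamentalRep (Fin N)) (N β') W` exist and EVERY DLR state is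
MASSIVE (`IsMassiveState`, rate `t`) with exponentially decaying plaquette–plaquette correlation function —
alongside `massGapOnBallZdW_of_robustStar` (exactly one DLR state + Shen–Zhu–Zhu clustering of Lipschitz observables)
from the SAME certificate. [folklore] -/
theorem massive_onBallZdW_of_robustStar (hN : 1 ≤ N)
    {β' κ ε₀ ε₁ Rm K c lam θ ρn t τb ρ' : ℝ} {D Kn : ℕ} (hD : 1 ≤ D)
    (hK : 0 ≤ K) (hRm : |(N : ℝ) * β'| / N * (2 * (((4 : ℕ) : ℝ) - 1)) ≤ Rm) (hmod : OneLinkKRModulus N Rm K)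
    (hε₁ : 0 ≤ ε₁)
    (hc : K * Real.exp ε₀ * (1 + 2 * Real.sqrt N * ε₁) * (|(N : ℝ) * β'| / N) ≤ c) (hlam : Real.sqrt N * ε₁ ≤ lam)
    (hθ : θ = (2 * ((4 : ℕ) : ℝ) - 2) * c + lam) (hθ1 : θ < 1) (hcd : doorPoly 4 c < 1)
    (hρn : ρn = gaugeR 4 c + (lam + θ ^ Kn * (4 * ((4 : ℕ) : ℝ) * lam)) / (1 - θ))
    (hκ : 0 < κ) (ht : 0 < t) (htκ : t ≤ κ)
    (hτb : (2 * Real.sqrt N) * ((((4 : ℕ) : ℝ) + 1) * Real.exp (-(κ * D)) * ε₁) ≤ τb)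
    (hclose : Real.exp τb ^ 2 * Real.exp (t * ((max (2 * D) 1 + 2 : ℕ) + 1)) * ρn +
        (2 * Real.sqrt N) * (Real.exp τb ^ 2 + Real.exp τb ^ 4) * ((((4 : ℕ) : ℝ) + 1) * Real.exp (-(κ * D)) * ε₁) *
          (Real.exp (t * ((max (2 * D) 1 + 2 : ℕ) + 1)) * ρn) +
        2 * (2 * Real.sqrt N) * (Real.exp τb ^ 2 + Real.exp τb ^ 4) *
          ((((4 : ℕ) : ℝ) + 1) * Real.exp (2 * t) * Real.exp (-((κ - t) * D)) * ε₁) ≤ ρ')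
    (hρ'0 : 0 ≤ ρ') (hρ'1 : ρ' < 1)
    {W : Potential (ZdEdge 4) (SUN N)} (hW : MemBallZdW κ ε₀ ε₁ W) :
    (perturbedGibbsMeasuresS (d := 4) (fundamentalRep (Fin N)) ((N : ℝ) * β') W).Nonempty ∧
      ∀ μ ∈ perturbedGibbsMeasuresS (d := 4) (fundamentalRep (Fin N)) ((N : ℝ) * β') W,
        IsMassiveState μ ∧ HasExponentialDecay (plaquetteCorrFn (fundamentalRep (Fin N)) μ) :=
  massive_of_starWindowBoundZdW hN hW ht htκ hρ'0 hρ'1 (fun _ _ => by positivity)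
    (fun s x hx y => starReach_dom y s hx)
    (starWindowBoundZdW_of_robustStar (d := 4) (by norm_num) hN hD hK hRm hmod hε₁ hc hlam hθ hθ1 hcd hρn hκ ht htκ
      hτb hclose hW)

/-- **VARIANCE FORM** of `starWindowBoundZdW_of_robustStar`: the hypotheses of `massGapOnBallZdW_of_robustStar_variance`
VERBATIM (near data: a Poincaré constant `cP` and a variance bound `v` at radius `b ≥ 2(d−1)|β'|`, `c ≥ e^{ε₀}√(cP v)|β'|`,
`lam ≥ e^{ε₀/2}√cP ε₁` — the every-`N` Bakry–Émery and PV pairs); conclusion: the weighted star window bound for every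
member. [folklore] -/
theorem starWindowBoundZdW_of_robustStar_variance (hd : 2 ≤ d) (hN : 1 ≤ N)
    {β' κ ε₀ ε₁ b cP v c lam θ ρn t τb ρ' : ℝ} {D Kn : ℕ} (hD : 1 ≤ D)
    (hcP : 0 ≤ cP) (hv : 0 ≤ v) (hb : |(N : ℝ) * β'| / N * (2 * ((d : ℝ) - 1)) ≤ b) (hP : OneLinkPoincareSUN N b cP)
    (hVB : OneLinkVarianceBound N b v) (hε₁ : 0 ≤ ε₁)
    (hc : Real.exp ε₀ * Real.sqrt (cP * v) * (|(N : ℝ) * β'| / N) ≤ c)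
    (hlam : Real.exp (ε₀ / 2) * Real.sqrt cP * ε₁ ≤ lam)
    (hθ : θ = (2 * (d : ℝ) - 2) * c + lam) (hθ1 : θ < 1) (hcd : doorPoly d c < 1)
    (hρn : ρn = gaugeR d c + (lam + θ ^ Kn * (4 * d * lam)) / (1 - θ))
    (hκ : 0 < κ) (ht : 0 < t) (htκ : t ≤ κ)
    (hτb : (2 * Real.sqrt N) * (((d : ℝ) + 1) * Real.exp (-(κ * D)) * ε₁) ≤ τb)
    (hclose : Real.exp τb ^ 2 * Real.exp (t * ((max (2 * D) 1 + 2 : ℕ) + 1)) * ρn +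
        (2 * Real.sqrt N) * (Real.exp τb ^ 2 + Real.exp τb ^ 4) * (((d : ℝ) + 1) * Real.exp (-(κ * D)) * ε₁) *
          (Real.exp (t * ((max (2 * D) 1 + 2 : ℕ) + 1)) * ρn) +
        2 * (2 * Real.sqrt N) * (Real.exp τb ^ 2 + Real.exp τb ^ 4) *
          (((d : ℝ) + 1) * Real.exp (2 * t) * Real.exp (-((κ - t) * D)) * ε₁) ≤ ρ')
    {W : Potential (ZdEdge d) (SUN N)} (hW : MemBallZdW κ ε₀ ε₁ W) :
    StarWindowBoundZdW d N (perturbedYMS (d := d) (fundamentalRep (Fin N)) ((N : ℝ) * β') W) t ρ'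
      (fun s y => ‖y.1 - s‖ + 1) suFrobDist := by
  have hD'eq : 2 * D + 2 ≤ max (2 * D) 1 + 2 := by omega
  have hnear : ∀ s : Site d, StarWindowBoundZdR d N
      (perturbedYM (d := d) (fundamentalRep (Fin N)) ((N : ℝ) * β') (truncZd D s W) (truncSuppZd D s))
      (max (2 * D) 1 + 2) ρn suFrobDist := fun s =>
    starWindowBoundZdR_of_memBallZdG_variance hd hN (Kn := Kn) hcP hv hb hP hVB hε₁ hc hlam hθ hθ1 hcd hρn
      (hW.truncZd_mem hκ.le D s)
  exact starWindowBoundZdW_of_near (N := N) hD'eq hκ ht.le htκ hτb (by exact_mod_cast hclose) hW hnear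

/-- ★★ **VARIANCE FORM, `d = 4`: every member of the tier-2 weighted `ℤ⁴` ball has a MASSIVE DLR state** — the
hypotheses of `massGapOnBallZdW_of_robustStar_variance` at `d = 4` (every-`N` Bakry–Émery / PV pairs, `SU(3)` PV cells);
conclusion as in `massive_onBallZdW_of_robustStar`. [folklore] -/
theorem massive_onBallZdW_of_robustStar_variance (hN : 1 ≤ N)
    {β' κ ε₀ ε₁ b cP v c lam θ ρn t τb ρ' : ℝ} {D Kn : ℕ} (hD : 1 ≤ D)
    (hcP : 0 ≤ cP) (hv : 0 ≤ v) (hb : |(N : ℝ) * β'| / N * (2 * (((4 : ℕ) : ℝ) - 1)) ≤ b) (hP : OneLinkPoincareSUN N b cP)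
    (hVB : OneLinkVarianceBound N b v) (hε₁ : 0 ≤ ε₁)
    (hc : Real.exp ε₀ * Real.sqrt (cP * v) * (|(N : ℝ) * β'| / N) ≤ c)
    (hlam : Real.exp (ε₀ / 2) * Real.sqrt cP * ε₁ ≤ lam)
    (hθ : θ = (2 * ((4 : ℕ) : ℝ) - 2) * c + lam) (hθ1 : θ < 1) (hcd : doorPoly 4 c < 1)
    (hρn : ρn = gaugeR 4 c + (lam + θ ^ Kn * (4 * ((4 : ℕ) : ℝ) * lam)) / (1 - θ))
    (hκ : 0 < κ) (ht : 0 < t) (htκ : t ≤ κ)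
    (hτb : (2 * Real.sqrt N) * ((((4 : ℕ) : ℝ) + 1) * Real.exp (-(κ * D)) * ε₁) ≤ τb)
    (hclose : Real.exp τb ^ 2 * Real.exp (t * ((max (2 * D) 1 + 2 : ℕ) + 1)) * ρn +
        (2 * Real.sqrt N) * (Real.exp τb ^ 2 + Real.exp τb ^ 4) * ((((4 : ℕ) : ℝ) + 1) * Real.exp (-(κ * D)) * ε₁) *
          (Real.exp (t * ((max (2 * D) 1 + 2 : ℕ) + 1)) * ρn) +
        2 * (2 * Real.sqrt N) * (Real.exp τb ^ 2 + Real.exp τb ^ 4) *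
          ((((4 : ℕ) : ℝ) + 1) * Real.exp (2 * t) * Real.exp (-((κ - t) * D)) * ε₁) ≤ ρ')
    (hρ'0 : 0 ≤ ρ') (hρ'1 : ρ' < 1)
    {W : Potential (ZdEdge 4) (SUN N)} (hW : MemBallZdW κ ε₀ ε₁ W) :
    (perturbedGibbsMeasuresS (d := 4) (fundamentalRep (Fin N)) ((N : ℝ) * β') W).Nonempty ∧
      ∀ μ ∈ perturbedGibbsMeasuresS (d := 4) (fundamentalRep (Fin N)) ((N : ℝ) * β') W,
        IsMassiveState μ ∧ HasExponentialDecay (plaquetteCorrFn (fundamentalRep (Fin N)) μ) :=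
  massive_of_starWindowBoundZdW hN hW ht htκ hρ'0 hρ'1 (fun _ _ => by positivity)
    (fun s x hx y => starReach_dom y s hx)
    (starWindowBoundZdW_of_robustStar_variance (d := 4) (by norm_num) hN hD hcP hv hb hP hVB hε₁ hc hlam hθ hθ1 hcd
      hρn hκ ht htκ hτb hclose hW)

/-- **EVERY `d ≥ 2`, BALL LEVEL: the Osterwalder–Seiler clause for every DLR state of every member of the tier-2 ball,
through the robust vertex-star door** — the hypotheses of `massGapOnBallZdW_of_robustStar` VERBATIM plus membership;
for `d = 3` this is the massive clause behind the `ℤ³` cells of `MassGapOnBallZdWRowsDim3` / `…SU3Dim3`. [folklore] -/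
theorem massiveClause_onBallZdW_of_robustStar (hd : 2 ≤ d) (hN : 1 ≤ N)
    {β' κ ε₀ ε₁ Rm K c lam θ ρn t τb ρ' : ℝ} {D Kn : ℕ} (hD : 1 ≤ D)
    (hK : 0 ≤ K) (hRm : |(N : ℝ) * β'| / N * (2 * ((d : ℝ) - 1)) ≤ Rm) (hmod : OneLinkKRModulus N Rm K)
    (hε₁ : 0 ≤ ε₁)
    (hc : K * Real.exp ε₀ * (1 + 2 * Real.sqrt N * ε₁) * (|(N : ℝ) * β'| / N) ≤ c) (hlam : Real.sqrt N * ε₁ ≤ lam)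
    (hθ : θ = (2 * (d : ℝ) - 2) * c + lam) (hθ1 : θ < 1) (hcd : doorPoly d c < 1)
    (hρn : ρn = gaugeR d c + (lam + θ ^ Kn * (4 * d * lam)) / (1 - θ))
    (hκ : 0 < κ) (ht : 0 < t) (htκ : t ≤ κ)
    (hτb : (2 * Real.sqrt N) * (((d : ℝ) + 1) * Real.exp (-(κ * D)) * ε₁) ≤ τb)
    (hclose : Real.exp τb ^ 2 * Real.exp (t * ((max (2 * D) 1 + 2 : ℕ) + 1)) * ρn +
        (2 * Real.sqrt N) * (Real.exp τb ^ 2 + Real.exp τb ^ 4) * (((d : ℝ) + 1) * Real.exp (-(κ * D)) * ε₁) *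
          (Real.exp (t * ((max (2 * D) 1 + 2 : ℕ) + 1)) * ρn) +
        2 * (2 * Real.sqrt N) * (Real.exp τb ^ 2 + Real.exp τb ^ 4) *
          (((d : ℝ) + 1) * Real.exp (2 * t) * Real.exp (-((κ - t) * D)) * ε₁) ≤ ρ')
    (hρ'0 : 0 ≤ ρ') (hρ'1 : ρ' < 1)
    {W : Potential (ZdEdge d) (SUN N)} (hW : MemBallZdW κ ε₀ ε₁ W) :
    ∀ μ ∈ perturbedGibbsMeasuresS (d := d) (fundamentalRep (Fin N)) ((N : ℝ) * β') W,
      ∃ m : ℝ, ∀ F₁ F₂ : LGConfig d (SUN N) → ℝ,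
        Literature.MathematicalPhysics.QuantumLattice.IsLocalObservable F₁ →
        Literature.MathematicalPhysics.QuantumLattice.IsLocalObservable F₂ →
        Measurable F₁ → Measurable F₂ → (∃ C, ∀ U, |F₁ U| ≤ C) → (∃ C, ∀ U, |F₂ U| ≤ C) →
          HasExponentialDecayRate
            (fun x : Site d => cov[F₁, fun U => F₂ (Literature.MathematicalPhysics.QuantumLattice.configShift x U); μ]) m :=
  massiveClause_of_starWindowBoundZdW (by omega) hN hW ht htκ hρ'0 hρ'1 (fun _ _ => by positivity)
    (fun s x hx y => starReach_dom y s hx)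
    (starWindowBoundZdW_of_robustStar hd hN hD hK hRm hmod hε₁ hc hlam hθ hθ1 hcd hρn hκ ht htκ hτb hclose hW)

end Summit.Ventures.YMGap.RobustBall

end
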